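import Summits.ValiantsHypothesis.ValiantsHypothesis.Theorems.LacunarySymmetroidMatrixDescartesZeroChangeStateDefs
import HarnessLib

/-!
# LINE (A) `product_plus_one` — r = 1 rung, state space: the EVERY-k implications and the ONE-ROW kernel theorems

Crux item stmt-ValiantsHypothesis-18050 (`MatrixDescartes`), LINE (A) `Lines/product_plus_one.lean` (skeleton 4c66814e33f05045), floor
`OneChangeFloorK3`, r = 1 rung «one W row × k zero-change rows» in crit-1 g11's state-space vocabulary (`…ZeroChangeStateDefs`).
KERNEL THEOREMS (source: val-idea-crit-1 g11 RESEARCH NOTES #430–#435 block of pen val-idea-25 g9's `Sketch-T3-s59.lean` rev 11,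
sha16 3c1b0a5138581e6c, farm rc 0 there; re-homed here verbatim up to the namespace, plus the pen's `PointwiseU1One.lean` core made
definition-free):

* `OmegaLogConcave_implies_PointwiseU2 k` — EXACT, every `k`: ΩLC ⇒ (P-U2)/(★) (at `K = 0`: `Ω₁ = (ρ+κ₁)Ω`, so `ΩΩ₂ < Ω₁²` gives
  `K₁ = Ω₂ − (ρ+κ₁)²Ω − κ₂Ω < −κ₂Ω < 0`);
* `ConcaveNumerator_implies_OmegaLogConcave k` — EXACT, every `k`: crit-1's Conjecture F ⇒ Conjecture E
  (`Ω·Ω'' − Ω'² = Ω·M'' − M'² − 2κ₂Ω²` at a state);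
* `OmegaLogConcave_one`, `ConcaveNumerator_one`, `PointwiseU2_one` — one-row blocks, every `ρ > 1` (the one-row `M(u)` is concave);
* `PointwiseU1_one` — (P-U1) for one row, every `ρ > 2` (pen §56.25 (3) / crit-1 #435: `2e²·h' = (4e² − 4e³ + 2ev)·h − 4e³v(ρ−2)`).

No `def`, no named fact, no sorry.  HONEST FRAMING: helper theorems of the r = 1 rung programme ((U2)-half for `k = 1`; the
every-`k` (U2)-half is THEOREM E∞ on paper, pen §56.24); nothing here closes `stub_oneChangeFloorK3` or any stub of LINE (A);
18050 / `MatrixDescartes` OPEN; `VP ≠ VNP` is NOT proved.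
-/

set_option linter.dupNamespace false

namespace Summit.ValiantsHypothesis.ValiantsHypothesis.Theorems.LacunarySymmetroidMatrixDescartes

namespace ZeroChangeState

open Finset
open scoped BigOperators

/-- EXACT: ΩLC implies the pen's (P-U2) pointwise criterion (★) for the same `k`
(at `K = 0`: `Ω₁ = (ρ+κ₁)Ω`, so `Ω·Ω₂ < Ω₁²` gives `Ω₂ < (ρ+κ₁)²Ω`, whence `K₁ = Ω₂ − (ρ+κ₁)Ω₁ − κ₂Ω = Ω₂ − (ρ+κ₁)²Ω − κ₂Ω < −κ₂Ω < 0`). -/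
theorem OmegaLogConcave_implies_PointwiseU2 (k : ℕ) : OmegaLogConcave k → PointwiseU2 k := by
  intro hLC ρ hρ E π hF hΩ hK
  have hlc := hLC ρ hρ E π hF hΩ
  have h1 : sOmega1 ρ E π = (ρ + bk1 ρ E π) * sOmega ρ E π := by
    unfold sK at hK; linarith
  have hb1 : 0 ≤ bk1 ρ E π := by
    unfold bk1
    apply Finset.sum_nonneg
    intro i _
    have hi := hF i
    unfold rowMoment
    nlinarith [hi.1, hi.2.1, hρ]
  have hb2 : 0 < bk2 ρ E π := by
    unfold sOmega at hΩ; nlinarith [hb1]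
  have h4 : sOmega2 ρ E π - (ρ + bk1 ρ E π) ^ 2 * sOmega ρ E π < 0 := by
    by_contra h
    push Not at h
    have h5 : 0 ≤ sOmega ρ E π * (sOmega2 ρ E π - (ρ + bk1 ρ E π) ^ 2 * sOmega ρ E π) :=
      mul_nonneg hΩ.le h
    rw [h1] at hlc
    nlinarith [hlc, h5]
  unfold sK1
  rw [h1]
  nlinarith [mul_pos hb2 hΩ, h4]


set_option maxHeartbeats 1600000 in
/-- **k = 1, every ρ > 1: Conjecture E holds for one-row blocks** (crit-1 g11 #433; previously exact only for ρ ≤ 5).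
Write `α = E 0 − ρ·π 0`, `p = π 0` (masses at the letters `1, ρ`; mass `1 − α − p` at `0`).  Along the flow
`Ω·P² = e^{ρu}·M(u)` with `M(u) = A + B e^{u} − C e^{(2−ρ)u} − D e^{ρu}`, `A = ρ(ρ−1)(1−α−p)p`, `B = ρ(ρ−5)αp`,
`C = 2α²`, `D = ρ(ρ+1)p²`; at the state `Ω = M₀`, `Ω' = (ρ − 2e)M₀ + M₁`, `Ω'' = M₂ − 2V·M₀ + (ρ−2e)²M₀ + 2(ρ−2e)M₁`
(`e = E 0 = κ₁`, `V = κ₂`, `M₁ = M'(0)`, `M₂ = M''(0)`), hence `Ω·Ω'' − Ω'² = M₀M₂ − M₁² − 2V·M₀²`, and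
`M₂ = ρ(ρ−5)αp − 2(ρ−2)²α² − ρ³(ρ+1)p² ≤ 0` (M is CONCAVE in u: for ρ ≤ 5 termwise, for ρ > 5 because
`ρ²(ρ−5)² < 8ρ³(ρ+1)(ρ−2)²`).  So `Ω·Ω'' < Ω'²` wherever `Ω > 0`. -/
theorem OmegaLogConcave_one : OmegaLogConcave 1 := by
  intro ρ hρ E π hF hΩ
  obtain ⟨hπ, hα, hr⟩ := hF 0
  have hρ0 : 0 < ρ := lt_trans zero_lt_one hρ
  have he0 : 0 ≤ E 0 := by nlinarith [mul_nonneg hρ0.le hπ]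
  -- Ω = V − e − e²
  have I0 : sOmega ρ E π = (E 0 + ρ * (ρ - 1) * π 0 - (E 0) ^ 2) - E 0 - (E 0) ^ 2 := by
    simp only [sOmega, bk1, bk2, rowMoment, Fin.sum_univ_one]; ring
  -- Ω = M₀
  have I1 : sOmega ρ E π =
      ρ * (ρ - 1) * (1 - (E 0 - ρ * π 0) - π 0) * π 0 + ρ * (ρ - 5) * (E 0 - ρ * π 0) * π 0
        - 2 * (E 0 - ρ * π 0) ^ 2 - ρ * (ρ + 1) * (π 0) ^ 2 := by
    simp only [sOmega, bk1, bk2, rowMoment, Fin.sum_univ_one]; ring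
  -- Ω' = (ρ − 2e)M₀ + M₁
  have I2 : sOmega1 ρ E π =
      (ρ - 2 * E 0) * (ρ * (ρ - 1) * (1 - (E 0 - ρ * π 0) - π 0) * π 0 + ρ * (ρ - 5) * (E 0 - ρ * π 0) * π 0
        - 2 * (E 0 - ρ * π 0) ^ 2 - ρ * (ρ + 1) * (π 0) ^ 2)
      + (ρ * (ρ - 5) * (E 0 - ρ * π 0) * π 0 + 2 * (ρ - 2) * (E 0 - ρ * π 0) ^ 2 - ρ ^ 2 * (ρ + 1) * (π 0) ^ 2) := by
    simp only [sOmega1, bk1, bk2, bk3, rowMoment, Fin.sum_univ_one]; ring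
  -- Ω'' = M₂ − 2V M₀ + (ρ − 2e)² M₀ + 2(ρ − 2e) M₁
  have I3 : sOmega2 ρ E π =
      (ρ * (ρ - 5) * (E 0 - ρ * π 0) * π 0 - 2 * (ρ - 2) ^ 2 * (E 0 - ρ * π 0) ^ 2 - ρ ^ 3 * (ρ + 1) * (π 0) ^ 2)
      - 2 * (E 0 + ρ * (ρ - 1) * π 0 - (E 0) ^ 2)
          * (ρ * (ρ - 1) * (1 - (E 0 - ρ * π 0) - π 0) * π 0 + ρ * (ρ - 5) * (E 0 - ρ * π 0) * π 0
            - 2 * (E 0 - ρ * π 0) ^ 2 - ρ * (ρ + 1) * (π 0) ^ 2)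
      + (ρ - 2 * E 0) ^ 2
          * (ρ * (ρ - 1) * (1 - (E 0 - ρ * π 0) - π 0) * π 0 + ρ * (ρ - 5) * (E 0 - ρ * π 0) * π 0
            - 2 * (E 0 - ρ * π 0) ^ 2 - ρ * (ρ + 1) * (π 0) ^ 2)
      + 2 * (ρ - 2 * E 0)
          * (ρ * (ρ - 5) * (E 0 - ρ * π 0) * π 0 + 2 * (ρ - 2) * (E 0 - ρ * π 0) ^ 2
            - ρ ^ 2 * (ρ + 1) * (π 0) ^ 2) := by
    simp only [sOmega2, bk1, bk2, bk3, bk4, rowMoment, Fin.sum_univ_one]; ring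
  -- V > 0 and M₀ > 0
  have hV : 0 < E 0 + ρ * (ρ - 1) * π 0 - (E 0) ^ 2 := by
    have h := hΩ; rw [I0] at h; nlinarith [he0, sq_nonneg (E 0)]
  have hM0 : 0 < ρ * (ρ - 1) * (1 - (E 0 - ρ * π 0) - π 0) * π 0 + ρ * (ρ - 5) * (E 0 - ρ * π 0) * π 0
        - 2 * (E 0 - ρ * π 0) ^ 2 - ρ * (ρ + 1) * (π 0) ^ 2 := by rw [I1] at hΩ; exact hΩ
  -- M₂ ≤ 0 (M concave)
  have hM2 : ρ * (ρ - 5) * (E 0 - ρ * π 0) * π 0 - 2 * (ρ - 2) ^ 2 * (E 0 - ρ * π 0) ^ 2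
        - ρ ^ 3 * (ρ + 1) * (π 0) ^ 2 ≤ 0 := by
    have hαp : 0 ≤ (E 0 - ρ * π 0) * π 0 := mul_nonneg hα hπ
    rcases le_or_gt ρ 5 with h5 | h5
    · have h1 : ρ * (ρ - 5) * ((E 0 - ρ * π 0) * π 0) ≤ 0 := by
        have : ρ * (ρ - 5) ≤ 0 := by nlinarith
        exact mul_nonpos_iff.mpr (Or.inr ⟨this, hαp⟩)
      nlinarith [sq_nonneg (E 0 - ρ * π 0), sq_nonneg (π 0), sq_nonneg (ρ - 2), h1,
        mul_nonneg (mul_nonneg (pow_nonneg hρ0.le 3) (by linarith : (0:ℝ) ≤ ρ + 1)) (sq_nonneg (π 0))]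
    · -- ρ(ρ−5)αp ≤ ρ²αp ≤ ρα²/4 + ρ³p² ≤ 2(ρ−2)²α² + ρ³(ρ+1)p²
      have h1 : ρ * (ρ - 5) * ((E 0 - ρ * π 0) * π 0) ≤ ρ ^ 2 * ((E 0 - ρ * π 0) * π 0) := by
        nlinarith [hαp]
      have h2 : ρ ^ 2 * ((E 0 - ρ * π 0) * π 0) ≤ ρ * (E 0 - ρ * π 0) ^ 2 / 4 + ρ ^ 3 * (π 0) ^ 2 := by
        nlinarith [mul_nonneg hρ0.le (sq_nonneg ((E 0 - ρ * π 0) / 2 - ρ * π 0))]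
      have h3 : ρ * (E 0 - ρ * π 0) ^ 2 / 4 ≤ 2 * (ρ - 2) ^ 2 * (E 0 - ρ * π 0) ^ 2 := by
        have : ρ / 4 ≤ 2 * (ρ - 2) ^ 2 := by nlinarith
        nlinarith [sq_nonneg (E 0 - ρ * π 0)]
      have h4 : ρ ^ 3 * (π 0) ^ 2 ≤ ρ ^ 3 * (ρ + 1) * (π 0) ^ 2 := by
        nlinarith [mul_nonneg (pow_nonneg hρ0.le 3) (sq_nonneg (π 0)), mul_nonneg (mul_nonneg (pow_nonneg hρ0.le 3) hρ0.le) (sq_nonneg (π 0))]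
      nlinarith [h1, h2, h3, h4]
  -- conclude: Ω Ω'' − Ω'² = M₀ M₂ − M₁² − 2 V M₀² < 0
  have hA := mul_nonneg hM0.le (neg_nonneg.mpr hM2)
  have hB := sq_nonneg (ρ * (ρ - 5) * (E 0 - ρ * π 0) * π 0 + 2 * (ρ - 2) * (E 0 - ρ * π 0) ^ 2
      - ρ ^ 2 * (ρ + 1) * (π 0) ^ 2)
  have hC := mul_pos hV (pow_pos hM0 2)
  rw [I1, I2, I3]
  generalize (ρ * (ρ - 1) * (1 - (E 0 - ρ * π 0) - π 0) * π 0 + ρ * (ρ - 5) * (E 0 - ρ * π 0) * π 0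
        - 2 * (E 0 - ρ * π 0) ^ 2 - ρ * (ρ + 1) * (π 0) ^ 2) = M0 at hA hC hM0 ⊢
  generalize (ρ * (ρ - 5) * (E 0 - ρ * π 0) * π 0 + 2 * (ρ - 2) * (E 0 - ρ * π 0) ^ 2
      - ρ ^ 2 * (ρ + 1) * (π 0) ^ 2) = M1 at hB ⊢
  generalize (ρ * (ρ - 5) * (E 0 - ρ * π 0) * π 0 - 2 * (ρ - 2) ^ 2 * (E 0 - ρ * π 0) ^ 2
        - ρ ^ 3 * (ρ + 1) * (π 0) ^ 2) = M2 at hA hM2 ⊢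
  generalize (E 0 + ρ * (ρ - 1) * π 0 - (E 0) ^ 2) = V at hC hV ⊢
  nlinarith [hA, hB, hC]

/-- Corollary (kernel-checked chain): (★)/(P-U2) for one-row blocks, all `ρ > 1`, via Conjecture E at `k = 1`. -/
theorem PointwiseU2_one : PointwiseU2 1 := OmegaLogConcave_implies_PointwiseU2 1 OmegaLogConcave_one

/-- EXACT, every k: Conjecture F implies Conjecture E (`Ω·Ω'' − Ω'² = Ω·M'' − M'² − 2κ₂Ω²` at a state). -/
theorem ConcaveNumerator_implies_OmegaLogConcave (k : ℕ) : ConcaveNumerator k → OmegaLogConcave k := by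
  intro hF ρ hρ E π hFe hΩ
  have hM2 := hF ρ hρ E π hFe
  have hb1 : 0 ≤ bk1 ρ E π := by
    unfold bk1
    apply Finset.sum_nonneg
    intro i _
    have hi := hFe i
    unfold rowMoment
    nlinarith [hi.1, hi.2.1, hρ]
  have hb2 : 0 < bk2 ρ E π := by
    unfold sOmega at hΩ; nlinarith [hb1]
  have key : sOmega ρ E π * sOmega2 ρ E π - sOmega1 ρ E π ^ 2
      = sOmega ρ E π * (sOmega2 ρ E π + 2 * (2 * bk1 ρ E π - ρ) * sOmega1 ρ E π
          + (2 * bk2 ρ E π + (2 * bk1 ρ E π - ρ) ^ 2) * sOmega ρ E π)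
        - (sOmega1 ρ E π + (2 * bk1 ρ E π - ρ) * sOmega ρ E π) ^ 2
        - 2 * bk2 ρ E π * sOmega ρ E π ^ 2 := by ring
  nlinarith [key, mul_nonpos_iff.mpr (Or.inl ⟨hΩ.le, hM2⟩),
    sq_nonneg (sOmega1 ρ E π + (2 * bk1 ρ E π - ρ) * sOmega ρ E π), mul_pos hb2 (pow_pos hΩ 2)]

set_option maxHeartbeats 1600000 in
/-- Conjecture F for one-row blocks, every ρ > 1 (the state form of `M'' = ρ(ρ−5)αp − 2(ρ−2)²α² − ρ³(ρ+1)p² ≤ 0`). -/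
theorem ConcaveNumerator_one : ConcaveNumerator 1 := by
  intro ρ hρ E π hF
  obtain ⟨hπ, hα, hr⟩ := hF 0
  have hρ0 : 0 < ρ := lt_trans zero_lt_one hρ
  have I : sOmega2 ρ E π + 2 * (2 * bk1 ρ E π - ρ) * sOmega1 ρ E π
      + (2 * bk2 ρ E π + (2 * bk1 ρ E π - ρ) ^ 2) * sOmega ρ E π
      = ρ * (ρ - 5) * (E 0 - ρ * π 0) * π 0 - 2 * (ρ - 2) ^ 2 * (E 0 - ρ * π 0) ^ 2
        - ρ ^ 3 * (ρ + 1) * (π 0) ^ 2 := by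
    simp only [sOmega, sOmega1, sOmega2, bk1, bk2, bk3, bk4, rowMoment, Fin.sum_univ_one]; ring
  rw [I]
  have hαp : 0 ≤ (E 0 - ρ * π 0) * π 0 := mul_nonneg hα hπ
  rcases le_or_gt ρ 5 with h5 | h5
  · have h1 : ρ * (ρ - 5) * ((E 0 - ρ * π 0) * π 0) ≤ 0 := by
      have : ρ * (ρ - 5) ≤ 0 := by nlinarith
      exact mul_nonpos_iff.mpr (Or.inr ⟨this, hαp⟩)
    nlinarith [sq_nonneg (E 0 - ρ * π 0), sq_nonneg (π 0), sq_nonneg (ρ - 2), h1,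
      mul_nonneg (mul_nonneg (pow_nonneg hρ0.le 3) (by linarith : (0:ℝ) ≤ ρ + 1)) (sq_nonneg (π 0))]
  · have h1 : ρ * (ρ - 5) * ((E 0 - ρ * π 0) * π 0) ≤ ρ ^ 2 * ((E 0 - ρ * π 0) * π 0) := by
      nlinarith [hαp]
    have h2 : ρ ^ 2 * ((E 0 - ρ * π 0) * π 0) ≤ ρ * (E 0 - ρ * π 0) ^ 2 / 4 + ρ ^ 3 * (π 0) ^ 2 := by
      nlinarith [mul_nonneg hρ0.le (sq_nonneg ((E 0 - ρ * π 0) / 2 - ρ * π 0))]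
    have h3 : ρ * (E 0 - ρ * π 0) ^ 2 / 4 ≤ 2 * (ρ - 2) ^ 2 * (E 0 - ρ * π 0) ^ 2 := by
      have : ρ / 4 ≤ 2 * (ρ - 2) ^ 2 := by nlinarith
      nlinarith [sq_nonneg (E 0 - ρ * π 0)]
    have h4 : ρ ^ 3 * (π 0) ^ 2 ≤ ρ ^ 3 * (ρ + 1) * (π 0) ^ 2 := by
      nlinarith [mul_nonneg (pow_nonneg hρ0.le 3) (sq_nonneg (π 0)), mul_nonneg (mul_nonneg (pow_nonneg hρ0.le 3) hρ0.le) (sq_nonneg (π 0))]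
    nlinarith [h1, h2, h3, h4]

/-- (P-U1) for ONE row, every `ρ > 2` (pen val-idea-25 g9 §56.25 (3), crit-1 VERDICT #435; the pen's kernel file `PointwiseU1One.lean`
made definition-free).  With `e = E 0`, `v = e(1−e) + ρ(ρ−1)π 0` (the row variance) and the gauge `β = ρ` (`2 ≤ ρ`):
`h = 2e²ρ − 2e³ − 4ev` and `2e²·h' = (4e² − 4e³ + 2ev)·h − 4e³v(ρ−2)`, so `h = 0 ⇒ h' < 0` (at `ρ = 2` the gauge is flat: crit-6 P11). -/
theorem PointwiseU1_one : PointwiseU1 1 := by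
  intro ρ hρ E π hF hb hsh
  obtain ⟨hπ0, hα0, hr0⟩ := hF 0
  have hρ0 : 0 < ρ := by linarith
  have hβ : sβ ρ = ρ := by unfold sβ; exact if_pos hρ.le
  have hb1 : bk1 ρ E π = E 0 := by
    simp only [bk1, rowMoment, Fin.sum_univ_one]; ring
  have hE : 0 < E 0 := by rw [hb1] at hb; exact hb
  -- the row variance is positive at a feasible non-constant state
  have hv : 0 < E 0 * (1 - E 0) + ρ * (ρ - 1) * π 0 := by
    have hid : E 0 * (1 - E 0) + ρ * (ρ - 1) * π 0
        = (1 - (E 0 - ρ * π 0) - π 0) * ((E 0 - ρ * π 0) + ρ ^ 2 * π 0)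
          + (E 0 - ρ * π 0) * π 0 * (ρ - 1) ^ 2 := by ring
    have hr' : 0 < 1 - (E 0 - ρ * π 0) - π 0 := by linarith
    have hpos : 0 < (E 0 - ρ * π 0) + ρ ^ 2 * π 0 := by
      nlinarith [mul_nonneg (mul_nonneg hρ0.le (by linarith : (0:ℝ) ≤ ρ - 1)) hπ0]
    rw [hid]
    exact add_pos_of_pos_of_nonneg (mul_pos hr' hpos) (mul_nonneg (mul_nonneg hα0 hπ0) (sq_nonneg _))
  -- dictionary: the gauged slope and its flow derivative in `(e, v)` coordinates
  have h1 : sh ρ E π = 2 * (E 0) ^ 2 * ρ - 2 * (E 0) ^ 3 - 4 * (E 0) * (E 0 * (1 - E 0) + ρ * (ρ - 1) * π 0) := by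
    simp only [sh, hβ, sOmega, sOmega1, bk1, bk2, bk3, rowMoment, Fin.sum_univ_one]
    ring
  have h2 : sh1 ρ E π = (-4 : ℝ) * (E 0) ^ 3 * ρ + 4 * (E 0) ^ 4 + 4 * (E 0) ^ 2 * ρ
      + 6 * (E 0) ^ 2 * (E 0 * (1 - E 0) + ρ * (ρ - 1) * π 0) - 4 * (E 0) ^ 3
      - 4 * (E 0 * (1 - E 0) + ρ * (ρ - 1) * π 0) ^ 2 - 4 * (E 0) * (E 0 * (1 - E 0) + ρ * (ρ - 1) * π 0) := by
    simp only [sh1, hβ, sOmega, sOmega1, sOmega2, bk1, bk2, bk3, bk4, rowMoment, Fin.sum_univ_one]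
    ring
  rw [h2]
  rw [h1] at hsh
  generalize E 0 = e at hE hv hsh ⊢
  generalize (e * (1 - e) + ρ * (ρ - 1) * π 0) = v at hv hsh ⊢
  -- key identity `2e²·h' = (4e² − 4e³ + 2ev)·h − 4e³v(ρ−2)` with `h = 0`
  have hid : 2 * e ^ 2 * ((-4 : ℝ) * e ^ 3 * ρ + 4 * e ^ 4 + 4 * e ^ 2 * ρ + 6 * e ^ 2 * v - 4 * e ^ 3
      - 4 * v ^ 2 - 4 * e * v)
      = (4 * e ^ 2 - 4 * e ^ 3 + 2 * e * v) * (2 * e ^ 2 * ρ - 2 * e ^ 3 - 4 * e * v) - 4 * e ^ 3 * v * (ρ - 2) := by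
    ring
  rw [hsh, mul_zero, zero_sub] at hid
  have hpos : 0 < 4 * e ^ 3 * v * (ρ - 2) := by
    have : 0 < ρ - 2 := by linarith
    positivity
  have he2 : 0 < 2 * e ^ 2 := by positivity
  by_contra hneg
  have : 0 ≤ 2 * e ^ 2 * ((-4 : ℝ) * e ^ 3 * ρ + 4 * e ^ 4 + 4 * e ^ 2 * ρ + 6 * e ^ 2 * v - 4 * e ^ 3
      - 4 * v ^ 2 - 4 * e * v) := mul_nonneg he2.le (not_lt.mp hneg)
  linarith

end ZeroChangeState

end Summit.ValiantsHypothesis.ValiantsHypothesis.Theorems.LacunarySymmetroidMatrixDescartes
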